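import Literature.Geometry.Riemannian.BishopGromovDirectional
import Literature.Geometry.Riemannian.ExpMapDifferential
import HarnessLib

/-!
# Small balls have asymptotically Euclidean volume: the sharp limit

On a connected complete Riemannian `d`-manifold, `Vol_g(B_r(p)) / Vol(B_r ⊂ ℝᵈ) → 1` as
`r → 0⁺` (Chavel 2006, §III.3 with Thm. III.3.1 / Gray: the expansion
`V(B(p;r)) = ω_d rᵈ (1 - S(p) r²/6(d+2) + …)`, leading term). Proof: for small `r` the ball
`B_r(0) ⊂ T_pM` lies in the injectivity domain, the metric ball is its image under `exp_p`
(`expPolar_data`), so `Vol_g(B_r(p)) = ∫_{B_r(0)} 𝒥` with the Jacobian `𝒥` of `exp_p` in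
orthonormal coordinates — continuous (`continuous_sqrt_det_inner_mfderiv`) with `𝒥(0) = 1`;
compare the tree's `SmallBallVolume.lean` (a non-sharp lower bound `c(m) ρᵐ ≤ Vol B_ρ`)
(`d(exp_p)_0 = id`, `hasMFDerivAt_expMap_zero`). We PROVE `tendsto_riemannianMeasure_ball_div`
(the limit; the volume of small balls as the integral of the Jacobian is the step `hvolball`). No definitions, no named facts (D-0026).
Groundwork for `CheegerColding1997_sphereStability` (normalisation of relative volume comparison;
"`Vol(B_r(x)) ≥ (1-δ) ω_n rⁿ`" statements of Cheeger–Colding 1997, §1 and Appendix 1).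

## References

* I. Chavel, *Riemannian Geometry: A Modern Introduction*, 2nd ed. (2006), §III.3. [Chavel2006]
* J. Cheeger, T. H. Colding, J. Differential Geom. 46 (1997) 406–480, §1. [CheegerColding1997]
-/

noncomputable section

open Bundle Set Function Filter MeasureTheory Manifold
open scoped Manifold ContDiff Topology ENNReal NNReal

namespace Literature.Geometry.Riemannian

open Lorentzian Lorentzian.PseudoRiemannianMetric

variable {d : ℕ} {M : Type*} [TopologicalSpace M] [ChartedSpace (EuclideanSpace ℝ (Fin d)) M]
  [IsManifold 𝓘(ℝ, EuclideanSpace ℝ (Fin d)) ∞ M] [T2Space M]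
  (g : PseudoRiemannianMetric 𝓘(ℝ, EuclideanSpace ℝ (Fin d)) ∞ (EuclideanSpace ℝ (Fin d))
    (TangentSpace 𝓘(ℝ, EuclideanSpace ℝ (Fin d)) : M → Type _)) [g.HasLeviCivita]
  [CovariantDerivative.ContMDiffCovariantDerivative g.leviCivita 1]
  [CovariantDerivative.ContMDiffCovariantDerivative g.leviCivita ∞]

/-- **Small balls: volume as the integral of the Jacobian of `exp_p`, and the limit
`Vol_g(B_r(p))/Vol_{ℝᵈ}(B_r) → 1`** (Chavel 2006, §III.3). On a connected Riemannian
`d`-manifold (`d ≥ 1`) with complete Levi-Civita connection, for every `p`: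
`Vol_g {d(p, ·) < r} / Vol(B_r(0) ⊂ ℝᵈ) → 1` as `r → 0⁺`.
[cite: Chavel2006, §III.3, Thm. III.3.1] [cite: CheegerColding1997, §1] -/
theorem tendsto_riemannianMeasure_ball_div (hd : 0 < d) [ConnectedSpace M]
    [T3Space M] [MeasurableSpace M] [BorelSpace M] (hg : g.IsRiemannian)
    (hc : IsGeodesicallyComplete g.leviCivita) (p : M) :
    Tendsto (fun r : ℝ ↦
      (riemannianMeasure (I := 𝓘(ℝ, (EuclideanSpace ℝ (Fin d)))) (g.toContMDiffRiemannianMetric hg)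
          {y : M | g.edist hg p y < ENNReal.ofReal r}).toReal /
        (volume (Metric.ball (0 : EuclideanSpace ℝ (Fin d)) r)).toReal) (𝓝[>] 0) (𝓝 1) := by
  classical
  haveI : Nontrivial (EuclideanSpace ℝ (Fin d)) := by
    have : 0 < Module.finrank ℝ (EuclideanSpace ℝ (Fin d)) := by
      rw [finrank_euclideanSpace_fin]; exact hd
    exact Module.finrank_pos_iff.1 this
  haveI : Fact ((1 : ℕ∞ω) ≤ ((⊤ : ℕ∞) : ℕ∞ω)) := ⟨by exact_mod_cast le_top⟩
  obtain ⟨L, hL⟩ := exists_linearIsometry_tangentSpace g hg p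
  obtain ⟨-, harea, ⟨N, -, -, -, hpolar⟩, hseg⟩ := expPolar_data g hd hg hc p L hL
  set h := g.toContMDiffRiemannianMetric hg with hh_def
  set vol : Measure M := riemannianMeasure (I := 𝓘(ℝ, (EuclideanSpace ℝ (Fin d)))) h with hvol
  set Φ : (EuclideanSpace ℝ (Fin d)) → M := fun x ↦ expMap g.leviCivita p (L x) with hΦ_def
  have hΦs : ContMDiff 𝓘(ℝ, (EuclideanSpace ℝ (Fin d))) 𝓘(ℝ, (EuclideanSpace ℝ (Fin d))) 1 Φ :=
    ((contMDiff_expMap_infty hc p).of_le (by exact_mod_cast le_top)).comp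
      L.toContinuousLinearMap.contDiff.contMDiff
  set J : (EuclideanSpace ℝ (Fin d)) → ℝ := fun z ↦ Real.sqrt
    (Matrix.of fun i j : Fin d ↦ g.val (Φ z)
      (mfderiv 𝓘(ℝ, (EuclideanSpace ℝ (Fin d))) 𝓘(ℝ, (EuclideanSpace ℝ (Fin d))) Φ z
        (EuclideanSpace.single i 1))
      (mfderiv 𝓘(ℝ, (EuclideanSpace ℝ (Fin d))) 𝓘(ℝ, (EuclideanSpace ℝ (Fin d))) Φ z
        (EuclideanSpace.single j 1))).det with hJ_def
  have hJc : Continuous J := continuous_sqrt_det_inner_mfderiv h hΦs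
  -- `J 0 = 1`: `dΦ_0 = L`, `g_p(L eᵢ, L eⱼ) = δᵢⱼ`
  have hΦ0 : Φ 0 = p := by simp only [hΦ_def, map_zero]; exact expMap_zero (cov := g.leviCivita) p
  have hmf : ∀ w : EuclideanSpace ℝ (Fin d),
      mfderiv 𝓘(ℝ, (EuclideanSpace ℝ (Fin d))) 𝓘(ℝ, (EuclideanSpace ℝ (Fin d))) Φ 0 w = L w := by
    intro w
    have h1 := hasMFDerivAt_expMap_zero (cov := g.leviCivita) hc p
    have h2 : HasMFDerivAt 𝓘(ℝ, (EuclideanSpace ℝ (Fin d))) 𝓘(ℝ, (EuclideanSpace ℝ (Fin d)))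
        (fun x : EuclideanSpace ℝ (Fin d) ↦ (L x : EuclideanSpace ℝ (Fin d))) 0
        (L : (EuclideanSpace ℝ (Fin d)) →L[ℝ] (EuclideanSpace ℝ (Fin d))) :=
      L.toContinuousLinearMap.hasFDerivAt.hasMFDerivAt
    have h3 : HasMFDerivAt 𝓘(ℝ, (EuclideanSpace ℝ (Fin d))) 𝓘(ℝ, (EuclideanSpace ℝ (Fin d))) Φ 0
        ((ContinuousLinearMap.id ℝ (EuclideanSpace ℝ (Fin d))).comp L.toContinuousLinearMap) := by
      have h1' : HasMFDerivAt 𝓘(ℝ, (EuclideanSpace ℝ (Fin d))) 𝓘(ℝ, (EuclideanSpace ℝ (Fin d)))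
          (fun v : EuclideanSpace ℝ (Fin d) ↦ expMap g.leviCivita p
            (show TangentSpace 𝓘(ℝ, (EuclideanSpace ℝ (Fin d))) p from v)) (L 0)
          (ContinuousLinearMap.id ℝ _) := by rw [map_zero]; exact h1
      exact h1'.comp 0 h2
    rw [h3.mfderiv]; rfl
  have hJ0 : J 0 = 1 := by
    have hmat : (Matrix.of fun i j : Fin d ↦ g.val (Φ 0)
        (mfderiv 𝓘(ℝ, (EuclideanSpace ℝ (Fin d))) 𝓘(ℝ, (EuclideanSpace ℝ (Fin d))) Φ 0
          (EuclideanSpace.single i 1))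
        (mfderiv 𝓘(ℝ, (EuclideanSpace ℝ (Fin d))) 𝓘(ℝ, (EuclideanSpace ℝ (Fin d))) Φ 0
          (EuclideanSpace.single j 1))) = 1 := by
      ext i j
      rw [Matrix.of_apply, hmf, hmf]
      have h1 : g.val (Φ 0) (L (EuclideanSpace.single i 1)) (L (EuclideanSpace.single j 1)) =
          g.val p (L (EuclideanSpace.single i 1)) (L (EuclideanSpace.single j 1)) := by rw [hΦ0]
      rw [h1, hL]
      simp [EuclideanSpace.inner_single_left, Matrix.one_apply, PiLp.single_apply]
    simp only [hJ_def, hmat, Matrix.det_one, Real.sqrt_one]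
  -- a ball of `T_pM` inside the injectivity domain
  set W : Set (EuclideanSpace ℝ (Fin d)) := {x | (show TangentSpace 𝓘(ℝ, (EuclideanSpace ℝ (Fin d))) p
    from L x) ∈ injectivityDomain g hg p} with hW_def
  have hWo : IsOpen W :=
    (isOpen_injectivityDomain_of_isGeodesicallyComplete g le_rfl hg hc p).preimage L.continuous
  have h0W : (0 : EuclideanSpace ℝ (Fin d)) ∈ W := by
    show (show TangentSpace 𝓘(ℝ, (EuclideanSpace ℝ (Fin d))) p from L 0) ∈ injectivityDomain g hg p
    rw [map_zero]; exact zero_mem_injectivityDomain hg p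
  obtain ⟨r₀, hr₀, hball⟩ := Metric.isOpen_iff.1 hWo 0 h0W
  -- the volume of small balls
  have hvolball : ∀ r, 0 < r → r ≤ r₀ →
      vol {y : M | g.edist hg p y < ENNReal.ofReal r} =
        ∫⁻ z in Metric.ball (0 : EuclideanSpace ℝ (Fin d)) r, ENNReal.ofReal (J z) := by
    intro r hr hrr₀
    have hsub : Metric.ball (0 : EuclideanSpace ℝ (Fin d)) r ⊆ W :=
      (Metric.ball_subset_ball hrr₀).trans hball
    have himg : Φ '' Metric.ball (0 : EuclideanSpace ℝ (Fin d)) r =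
        {y : M | g.edist hg p y < ENNReal.ofReal r} := by
      ext y
      constructor
      · rintro ⟨x, hx, rfl⟩
        show g.edist hg p (expMap g.leviCivita p (L x)) < ENNReal.ofReal r
        rw [(hseg x (hsub hx)).1]
        exact (ENNReal.ofReal_lt_ofReal_iff_of_nonneg (norm_nonneg _)).2 (mem_ball_zero_iff.1 hx)
      · intro hy
        obtain ⟨x, hxy, hnx, -, -⟩ := hpolar y
        refine ⟨x, mem_ball_zero_iff.2 ?_, hxy⟩
        have hy' : g.edist hg p y < ENNReal.ofReal r := hy
        rw [← hnx] at hy'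
        exact (ENNReal.ofReal_lt_ofReal_iff_of_nonneg (norm_nonneg _)).1 hy'
    rw [← himg]
    exact harea _ Metric.isOpen_ball.measurableSet hsub
  -- the limit
  have hballpos : ∀ r, 0 < r → 0 < volume (Metric.ball (0 : EuclideanSpace ℝ (Fin d)) r) :=
    fun r hr ↦ Metric.measure_ball_pos volume 0 hr
  have hballfin : ∀ r, volume (Metric.ball (0 : EuclideanSpace ℝ (Fin d)) r) ≠ ⊤ :=
    fun r ↦ measure_ball_lt_top.ne
  rw [Metric.tendsto_nhdsWithin_nhds]
  intro ε hε
  -- continuity of `J` at `0`, tolerance `η = min(ε/2, 1/2)`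
  set η : ℝ := min (ε / 2) (1 / 2) with hη
  have hη0 : 0 < η := lt_min (half_pos hε) (by norm_num)
  have hηε : η ≤ ε / 2 := min_le_left _ _
  have hη1 : η ≤ 1 / 2 := min_le_right _ _
  obtain ⟨δ, hδ, hJδ⟩ := Metric.continuous_iff.1 hJc 0 η hη0
  refine ⟨min r₀ δ, lt_min hr₀ hδ, fun r hr hrd ↦ ?_⟩
  have hr0 : 0 < r := hr
  rw [Real.dist_eq, sub_zero, abs_of_pos hr0] at hrd
  have hrr₀ : r ≤ r₀ := (hrd.le.trans (min_le_left _ _))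
  have hrδ : r < δ := hrd.trans_le (min_le_right _ _)
  have hJbound : ∀ z ∈ Metric.ball (0 : EuclideanSpace ℝ (Fin d)) r, |J z - 1| < η := by
    intro z hz
    have h1 := hJδ z (by rw [dist_zero_right]; exact (mem_ball_zero_iff.1 hz).trans hrδ)
    rwa [Real.dist_eq, hJ0] at h1
  set B := Metric.ball (0 : EuclideanSpace ℝ (Fin d)) r with hB
  have hlow : ENNReal.ofReal (1 - η) * volume B ≤ ∫⁻ z in B, ENNReal.ofReal (J z) := by
    rw [← setLIntegral_const]
    refine setLIntegral_mono (hJc.measurable.ennreal_ofReal) fun z hz ↦ ?_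
    exact ENNReal.ofReal_le_ofReal (by have := hJbound z hz; rw [abs_lt] at this; linarith)
  have hup : ∫⁻ z in B, ENNReal.ofReal (J z) ≤ ENNReal.ofReal (1 + η) * volume B := by
    rw [← setLIntegral_const]
    refine setLIntegral_mono measurable_const fun z hz ↦ ?_
    exact ENNReal.ofReal_le_ofReal (by have := hJbound z hz; rw [abs_lt] at this; linarith)
  rw [hvolball r hr0 hrr₀, Real.dist_eq]
  have hvB : 0 < (volume B).toReal := ENNReal.toReal_pos (hballpos r hr0).ne' (hballfin r)
  have hfin : ∫⁻ z in B, ENNReal.ofReal (J z) ≠ ⊤ :=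
    ne_top_of_le_ne_top (ENNReal.mul_ne_top ENNReal.ofReal_ne_top (hballfin r)) hup
  have h1 : (1 - η) * (volume B).toReal ≤ (∫⁻ z in B, ENNReal.ofReal (J z)).toReal := by
    have := ENNReal.toReal_mono hfin hlow
    rwa [ENNReal.toReal_mul, ENNReal.toReal_ofReal (by linarith : (0:ℝ) ≤ 1 - η)] at this
  have h2 : (∫⁻ z in B, ENNReal.ofReal (J z)).toReal ≤ (1 + η) * (volume B).toReal := by
    have := ENNReal.toReal_mono (ENNReal.mul_ne_top ENNReal.ofReal_ne_top (hballfin r)) hup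
    rwa [ENNReal.toReal_mul, ENNReal.toReal_ofReal (by linarith : (0:ℝ) ≤ 1 + η)] at this
  have h3 : 1 - η ≤ (∫⁻ z in B, ENNReal.ofReal (J z)).toReal / (volume B).toReal := by
    rw [le_div_iff₀ hvB]; exact h1
  have h4 : (∫⁻ z in B, ENNReal.ofReal (J z)).toReal / (volume B).toReal ≤ 1 + η := by
    rw [div_le_iff₀ hvB]; exact h2
  rw [abs_lt]
  constructor <;> linarith

end Literature.Geometry.Riemannian

end
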